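import Mathlib
import Summits.NavierStokesRegularity.NavierStokesRegularity.Theorems.EulerZoomLiouvillePowerGaugeEulerLiouvilleSpiralVorticityTransport
import HarnessLib

/-!
# Crux `EulerZoomLiouville.PowerGaugeEulerLiouville` (stmt-NavierStokesRegularity-19832), line `relative_equilibria`
# (R2, spiral vortical escape): vorticity along backward SPIRAL half-orbits — the Cauchy law and the SPIRAL ORBIT KILL

Route №10 `EulerZoomLiouville` (NavierStokesRegularity), crux E = stmt-NavierStokesRegularity-19832.  Companion of
`…SpiralVorticityTransport` (the spiral vorticity identity `(W_S·∇)Ω = (Ω·∇)V − Ω + SΩ` and the commutator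
`[W_S, Ω] = −(1+γ)Ω` for classical spiral profiles, `W_S = V + γy + Sy`, `S` skew).  This file is the TWISTED twin of the
trajectory lemmas of `…SelfSimilarVorticityTransport` / `…SelfSimilarHalfOrbitKill` (untwisted case `S = 0`), for a curve
`Y` solving `Y' = σ W_S(Y)` (resp. the backward ODE `Y' = −W_S(Y)` on `[0, ∞)` only), plates (iii) and P-a of the R2-ESC
obstruction memo (evidence #50/#51 on the crux item, §1(a)–(b), §4):

* `hasDerivAt_curl_comp_spiral` — `d/dt Ω(Y) = σ(DW_S(Y)Ω(Y) − (1+γ)Ω(Y))`; backward form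
  `hasDerivAt_curl_comp_spiral_backward` — `d/dt Ω(Y) = (1 − DV(Y) − S)Ω(Y)`;
* `hasDerivAt_weightedCurl_comp_spiral` — the quantitative Cauchy formula as a linear ODE: `u = e^{σ(1+γ)t}Ω(Y)` solves
  `u' = σ DW_S(Y) u`;
* `hasDerivAt_norm_curl_comp_sq_spiral` — **`d/dt ‖Ω(Y)‖² = 2(‖Ω‖² − ⟪DV(Y)Ω, Ω⟫)` backward: THE TWIST DROPS OUT**
  (`⟪SΩ, Ω⟫ = 0`), the stretching of `|Ω|` along backward spiral orbits is literally the untwisted one;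
* `curl_comp_eq_zero_of_curl_comp_eq_zero_of_Ici_spiral` — flow invariance of `{Ω = 0}` along bounded backward half-orbits;
* `curl_comp_eq_zero_of_eventually_stretching_le_of_Ici_spiral` — **SPIRAL ORBIT KILL** (plate P-a): eventually subcritical
  stretching `⟪DV(Y)w, w⟫ ≤ θ|w|²`, `θ < 1`, along a bounded backward spiral half-orbit forces `Ω(Y(0)) = 0`.

WHAT THIS IS NOT: not NS, not E — S-free Lagrangian bookkeeping (portrait bricks for R2 of line `relative_equilibria`; its open
content, RECURRENCE EXCLUSION for confined backward `W_S`-orbits, is untouched: the Bernoulli/Barbalat step of the untwisted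
LIMIT-SET KILL does not port, torque term `(1−2γ)⟪W_S, Sy⟫`); the crux 19832 is OPEN.

## References

* P. Constantin, M. Ignatova, V. Vicol, arXiv:2602.17570 (2026), §3.4.1 (3.21)–(3.22), §3.5 proof of Thm 3.10.
  [ConstantinIgnatovaVicol2026Putative]
* B. Pineau, V. Vicol, arXiv:2607.09619 (2026), §3 eq. (3.3). [PineauVicol2026]
-/

noncomputable section

-- flat `Theorems/<Route><Decl>…` files of one crux share the namespace of the crux (tree convention)
set_option linter.dupNamespace false

open Set Filter Topology Metric Function InnerProductSpace
open scoped RealInnerProductSpace NNReal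

namespace Summit.NavierStokesRegularity.NavierStokesRegularity.Theorems.PowerGaugeEulerLiouville.Spiral

open Literature.Analysis Literature.Analysis.FluidPDE

variable {γ : ℝ} {S : EuclideanSpace ℝ (Fin 3) →L[ℝ] EuclideanSpace ℝ (Fin 3)}
  {V : EuclideanSpace ℝ (Fin 3) → EuclideanSpace ℝ (Fin 3)} {P : EuclideanSpace ℝ (Fin 3) → ℝ}

/-! ### Vorticity along spiral-wind trajectories: the Cauchy law -/

/-- **`d/dt Ω(Y(t)) = σ (DW_S(Y) Ω(Y) − (1+γ) Ω(Y))` along `Y' = σ W_S(Y)`** (chain rule + the commutator identity).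
[cite: ConstantinIgnatovaVicol2026Putative, §3.4.1 eq. (3.22)] -/
theorem hasDerivAt_curl_comp_spiral (hS : ∀ x y : EuclideanSpace ℝ (Fin 3), ⟪S x, y⟫ = -⟪x, S y⟫)
    (hV : ContDiff ℝ 2 V) (hP : ContDiff ℝ 1 P) (hdiv : VectorCalculus.IsDivFree V)
    (heq : ∀ y, (1 - γ) • V y - S (V y) + fderiv ℝ V y (V y + γ • y + S y) + gradient P y = 0)
    {σ : ℝ} {Y : ℝ → EuclideanSpace ℝ (Fin 3)} {t : ℝ} (hY : HasDerivAt Y (σ • (V (Y t) + γ • Y t + S (Y t))) t) :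
    HasDerivAt (fun s => curl V (Y s))
      (σ • (fderiv ℝ (fun z => V z + γ • z + S z) (Y t) (curl V (Y t)) - (1 + γ) • curl V (Y t))) t := by
  have hdc : DifferentiableAt ℝ (curl V) (Y t) := (differentiable_curl_of_contDiff hV) _
  have h1 : HasDerivAt (fun s => curl V (Y s))
      (fderiv ℝ (curl V) (Y t) (σ • (V (Y t) + γ • Y t + S (Y t)))) t := hdc.hasFDerivAt.comp_hasDerivAt t hY
  refine h1.congr_deriv ?_
  rw [map_smul]
  congr 1
  have e := fderiv_curl_spiralWind_sub hS hV hP hdiv heq (Y t)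
  rw [sub_eq_iff_eq_add] at e
  rw [e]
  abel

/-- **Backward spiral trajectories**: along `Y' = −W_S(Y)`, `d/dt Ω(Y) = Ω(Y) − DV(Y)Ω(Y) − SΩ(Y) = (1 − DV(Y) − S)Ω(Y)`.
[cite: ConstantinIgnatovaVicol2026Putative, §3.4.1 eq. (3.22)] -/
theorem hasDerivAt_curl_comp_spiral_backward (hS : ∀ x y : EuclideanSpace ℝ (Fin 3), ⟪S x, y⟫ = -⟪x, S y⟫)
    (hV : ContDiff ℝ 2 V) (hP : ContDiff ℝ 1 P) (hdiv : VectorCalculus.IsDivFree V)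
    (heq : ∀ y, (1 - γ) • V y - S (V y) + fderiv ℝ V y (V y + γ • y + S y) + gradient P y = 0)
    {Y : ℝ → EuclideanSpace ℝ (Fin 3)} {t : ℝ} (hY : HasDerivAt Y ((-1 : ℝ) • (V (Y t) + γ • Y t + S (Y t))) t) :
    HasDerivAt (fun s => curl V (Y s))
      (curl V (Y t) - fderiv ℝ V (Y t) (curl V (Y t)) - S (curl V (Y t))) t := by
  have h := hasDerivAt_curl_comp_spiral hS hV hP hdiv heq hY
  refine h.congr_deriv ?_
  rw [fderiv_spiralWind (hV.differentiable (by norm_num)) (Y t), _root_.add_apply, _root_.add_apply, _root_.smul_apply,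
    ContinuousLinearMap.id_apply]
  module

/-- **The quantitative Cauchy formula as a linear ODE, twisted case**: along `Y' = σ W_S(Y)` the weighted vorticity
`u(t) = e^{σ(1+γ)t} Ω(Y(t))` solves `u' = (σ DW_S(Y(t))) u` — literally the untwisted law with `DW_S = DV + γ·1 + S`.
[cite: ConstantinIgnatovaVicol2026Putative, §3.4.1 eq. (3.22)] -/
theorem hasDerivAt_weightedCurl_comp_spiral (hS : ∀ x y : EuclideanSpace ℝ (Fin 3), ⟪S x, y⟫ = -⟪x, S y⟫)
    (hV : ContDiff ℝ 2 V) (hP : ContDiff ℝ 1 P) (hdiv : VectorCalculus.IsDivFree V)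
    (heq : ∀ y, (1 - γ) • V y - S (V y) + fderiv ℝ V y (V y + γ • y + S y) + gradient P y = 0)
    {σ : ℝ} {Y : ℝ → EuclideanSpace ℝ (Fin 3)} {t : ℝ} (hY : HasDerivAt Y (σ • (V (Y t) + γ • Y t + S (Y t))) t) :
    HasDerivAt (fun s => Real.exp (σ * (1 + γ) * s) • curl V (Y s))
      ((σ • fderiv ℝ (fun z => V z + γ • z + S z) (Y t)) (Real.exp (σ * (1 + γ) * t) • curl V (Y t))) t := by
  have h1 : HasDerivAt (fun s : ℝ => Real.exp (σ * (1 + γ) * s)) (Real.exp (σ * (1 + γ) * t) * (σ * (1 + γ) * 1)) t :=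
    ((hasDerivAt_id t).const_mul (σ * (1 + γ))).exp
  have h := h1.smul (hasDerivAt_curl_comp_spiral hS hV hP hdiv heq hY)
  refine h.congr_deriv ?_
  rw [FunLike.coe_smul, Pi.smul_apply, map_smul, smul_sub, smul_smul]
  module

/-- **`d/dt ‖Ω(Y)‖² = 2(‖Ω‖² − ⟪DV(Y)Ω, Ω⟫)` along backward spiral trajectories — THE TWIST DROPS OUT** (`⟪SΩ, Ω⟫ = 0`):
the stretching of `|Ω|` along backward `W_S`-orbits is the untwisted one (R2-ESC memo §1(a)).
[cite: ConstantinIgnatovaVicol2026Putative, §3.4.1 eq. (3.22)] -/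
theorem hasDerivAt_norm_curl_comp_sq_spiral (hS : ∀ x y : EuclideanSpace ℝ (Fin 3), ⟪S x, y⟫ = -⟪x, S y⟫)
    (hV : ContDiff ℝ 2 V) (hP : ContDiff ℝ 1 P) (hdiv : VectorCalculus.IsDivFree V)
    (heq : ∀ y, (1 - γ) • V y - S (V y) + fderiv ℝ V y (V y + γ • y + S y) + gradient P y = 0)
    {Y : ℝ → EuclideanSpace ℝ (Fin 3)} {t : ℝ} (hY : HasDerivAt Y ((-1 : ℝ) • (V (Y t) + γ • Y t + S (Y t))) t) :
    HasDerivAt (fun s => ‖curl V (Y s)‖ ^ 2)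
      (2 * (‖curl V (Y t)‖ ^ 2 - ⟪fderiv ℝ V (Y t) (curl V (Y t)), curl V (Y t)⟫)) t := by
  have h1 := (hasDerivAt_curl_comp_spiral_backward hS hV hP hdiv heq hY).norm_sq
  refine h1.congr_deriv ?_
  have h0 : ⟪curl V (Y t), S (curl V (Y t))⟫ = 0 := by
    rw [real_inner_comm]; exact inner_skew_apply_self hS _
  rw [inner_sub_right, inner_sub_right, real_inner_self_eq_norm_sq, h0,
    real_inner_comm (curl V (Y t)) (fderiv ℝ V (Y t) (curl V (Y t)))]
  ring

/-! ### Flow invariance of the irrotational set and the SPIRAL ORBIT KILL (plate P-a) -/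

/-- On a ball the spiral-wind gradient `DW_S = DV + γ·1 + S` is bounded (continuity of `DV`). [folklore] -/
theorem exists_bound_fderiv_spiralWind (hV : ContDiff ℝ 2 V) (B : ℝ) :
    ∃ L, 0 ≤ L ∧ ∀ y ∈ closedBall (0 : EuclideanSpace ℝ (Fin 3)) B,
      ‖fderiv ℝ (fun z => V z + γ • z + S z) y‖ ≤ L := by
  have hVd : Differentiable ℝ V := hV.differentiable (by norm_num)
  have hc : Continuous fun y => fderiv ℝ (fun z => V z + γ • z + S z) y := by
    have e : (fun y => fderiv ℝ (fun z => V z + γ • z + S z) y) =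
        fun y => fderiv ℝ V y + γ • ContinuousLinearMap.id ℝ (EuclideanSpace ℝ (Fin 3)) + S :=
      funext (fderiv_spiralWind hVd)
    rw [e]
    exact ((hV.continuous_fderiv (by norm_num)).add continuous_const).add continuous_const
  obtain ⟨L, hL⟩ := (isCompact_closedBall (0 : EuclideanSpace ℝ (Fin 3)) B).exists_bound_of_continuousOn hc.continuousOn
  exact ⟨max L 0, le_max_right _ _, fun y hy => (hL y hy).trans (le_max_left _ _)⟩

/-- **`{Ω = 0}` is invariant along backward spiral half-orbits**: if `Y' = −W_S(Y)` on `[0,∞)`, `‖Y(t)‖ ≤ B` for `t ≥ 0`, and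
`Ω(Y(T)) = 0` at some `T ≥ 0`, then `Ω(Y(0)) = 0` (uniqueness for the linear equation `dΩ(Y)/dt = (1 − DV(Y) − S)Ω(Y)` on
`[0, T]`).  Twin of `NodalContinuum.curl_comp_eq_zero_of_curl_comp_eq_zero_of_Ici`. [cite: ConstantinIgnatovaVicol2026Putative, §3.4.1 eq. (3.22)] -/
theorem curl_comp_eq_zero_of_curl_comp_eq_zero_of_Ici_spiral
    (hS : ∀ x y : EuclideanSpace ℝ (Fin 3), ⟪S x, y⟫ = -⟪x, S y⟫)
    (hV : ContDiff ℝ 2 V) (hP : ContDiff ℝ 1 P) (hdiv : VectorCalculus.IsDivFree V)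
    (heq : ∀ y, (1 - γ) • V y - S (V y) + fderiv ℝ V y (V y + γ • y + S y) + gradient P y = 0)
    {Y : ℝ → EuclideanSpace ℝ (Fin 3)}
    (hY : ∀ t, 0 ≤ t → HasDerivAt Y ((-1 : ℝ) • (V (Y t) + γ • Y t + S (Y t))) t)
    {B : ℝ} (hB : ∀ t, 0 ≤ t → ‖Y t‖ ≤ B) {T : ℝ} (hT : 0 ≤ T) (h0 : curl V (Y T) = 0) :
    curl V (Y 0) = 0 := by
  set A : ℝ → EuclideanSpace ℝ (Fin 3) →L[ℝ] EuclideanSpace ℝ (Fin 3) :=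
    fun t => (-1 : ℝ) • (fderiv ℝ (fun z => V z + γ • z + S z) (Y t) - (1 + γ) • ContinuousLinearMap.id ℝ _) with hA
  set u : ℝ → EuclideanSpace ℝ (Fin 3) := fun s => curl V (Y s) with hu
  have hu' : ∀ t, 0 ≤ t → HasDerivAt u (A t (u t)) t := by
    intro t ht
    have := hasDerivAt_curl_comp_spiral hS hV hP hdiv heq (hY t ht)
    refine this.congr_deriv ?_
    simp [hA, hu]
  obtain ⟨L, hL0, hL⟩ := exists_bound_fderiv_spiralWind (γ := γ) (S := S) hV B
  have hKV : ∀ t ∈ Ioc 0 T, LipschitzOnWith (Real.toNNReal (L + |1 + γ|))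
      (fun x : EuclideanSpace ℝ (Fin 3) => A t x) univ := by
    intro t ht
    refine ((A t).lipschitz.weaken ?_).lipschitzOnWith
    rw [← NNReal.coe_le_coe, coe_nnnorm, Real.coe_toNNReal _ (by positivity)]
    have hYt : Y t ∈ closedBall (0 : EuclideanSpace ℝ (Fin 3)) B := mem_closedBall_zero_iff.2 (hB t ht.1.le)
    calc ‖A t‖ = ‖fderiv ℝ (fun z => V z + γ • z + S z) (Y t) -
          (1 + γ) • ContinuousLinearMap.id ℝ (EuclideanSpace ℝ (Fin 3))‖ := by
          simp only [hA]; rw [norm_smul, norm_neg, norm_one, one_mul]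
      _ ≤ ‖fderiv ℝ (fun z => V z + γ • z + S z) (Y t)‖ +
          ‖(1 + γ) • ContinuousLinearMap.id ℝ (EuclideanSpace ℝ (Fin 3))‖ := norm_sub_le _ _
      _ ≤ L + |1 + γ| := by
          refine add_le_add (hL _ hYt) ?_
          rw [norm_smul, Real.norm_eq_abs]
          exact mul_le_of_le_one_right (abs_nonneg _) ContinuousLinearMap.norm_id_le
  have hcont : ContinuousOn u (Icc 0 T) := fun t ht => (hu' t ht.1).continuousAt.continuousWithinAt
  have hEq : EqOn u (fun _ => (0 : EuclideanSpace ℝ (Fin 3))) (Icc 0 T) :=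
    ODE_solution_unique_of_mem_Icc_left (v := fun t x => A t x) (s := fun _ => univ)
      hKV hcont (fun t ht => (hu' t ht.1.le).hasDerivWithinAt) (fun _ _ => mem_univ _)
      continuousOn_const
      (fun t _ => by
        have h0' : HasDerivWithinAt (fun _ : ℝ => (0 : EuclideanSpace ℝ (Fin 3))) 0 (Iic t) t :=
          hasDerivWithinAt_const _ _ _
        simpa using h0')
      (fun _ _ => mem_univ _) (by simpa [hu] using h0)
  exact hEq ⟨le_rfl, hT⟩

/-- **SPIRAL ORBIT KILL (plate P-a; no convergence needed).**  Let `(V, P)` be a classical spiral profile with skew generator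
`S` and `Y` a backward spiral trajectory (`Y' = −W_S(Y)`, `W_S = V + γy + Sy`) bounded for `t ≥ 0`.  If from some time `T ≥ 0`
on `⟪DV(Y(t))w, w⟫ ≤ θ|w|²` for all `w` with one `θ < 1`, then `Ω(Y(0)) = 0`: `|Ω(Y)|²e^{−2(1−θ)t}` is nondecreasing on
`[T, ∞)` (the twist drops out of `d|Ω(Y)|²/dt`) while `Ω(Y)` is bounded, so `Ω(Y(T)) = 0`, and `Ω(Y(0)) = 0` by flow
invariance.  Twin of `NodalContinuum.curl_comp_eq_zero_of_eventually_stretching_le_of_Ici` (`S = 0`).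
[cite: ConstantinIgnatovaVicol2026Putative, §3.4.1 eq. (3.22) and §3.5 proof of Thm 3.10 (trajectory-wise, sharpened)] -/
theorem curl_comp_eq_zero_of_eventually_stretching_le_of_Ici_spiral
    (hS : ∀ x y : EuclideanSpace ℝ (Fin 3), ⟪S x, y⟫ = -⟪x, S y⟫)
    (hV : ContDiff ℝ 2 V) (hP : ContDiff ℝ 1 P) (hdiv : VectorCalculus.IsDivFree V)
    (heq : ∀ y, (1 - γ) • V y - S (V y) + fderiv ℝ V y (V y + γ • y + S y) + gradient P y = 0)
    {Y : ℝ → EuclideanSpace ℝ (Fin 3)}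
    (hY : ∀ t, 0 ≤ t → HasDerivAt Y ((-1 : ℝ) • (V (Y t) + γ • Y t + S (Y t))) t)
    {B : ℝ} (hB : ∀ t, 0 ≤ t → ‖Y t‖ ≤ B) {θ : ℝ} (hθ : θ < 1) {T : ℝ} (hT : 0 ≤ T)
    (hstretch : ∀ t, T ≤ t → ∀ w : EuclideanSpace ℝ (Fin 3), ⟪fderiv ℝ V (Y t) w, w⟫ ≤ θ * ‖w‖ ^ 2) :
    curl V (Y 0) = 0 := by
  set f : ℝ → ℝ := fun s => ‖curl V (Y s)‖ ^ 2 with hf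
  set κ : ℝ := 2 * (1 - θ) with hκ
  have hκpos : 0 < κ := by rw [hκ]; linarith
  -- `g s = e^{-κ s} f s` is nondecreasing on `[T, ∞)`
  set g : ℝ → ℝ := fun s => Real.exp (-κ * s) * f s with hg
  have hg' : ∀ s, 0 ≤ s → HasDerivAt g (Real.exp (-κ * s) *
      (2 * (‖curl V (Y s)‖ ^ 2 - ⟪fderiv ℝ V (Y s) (curl V (Y s)), curl V (Y s)⟫) - κ * f s)) s := by
    intro s hs0
    have he : HasDerivAt (fun s => Real.exp (-κ * s)) (Real.exp (-κ * s) * (-κ * 1)) s :=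
      ((hasDerivAt_id s).const_mul (-κ)).exp
    have := he.mul (hasDerivAt_norm_curl_comp_sq_spiral hS hV hP hdiv heq (hY s hs0))
    refine this.congr_deriv ?_
    simp only [hf]
    ring
  have hgmono : MonotoneOn g (Ici T) := by
    refine monotoneOn_of_hasDerivWithinAt_nonneg (convex_Ici T)
      (fun s hs => (hg' s (hT.trans (mem_Ici.1 hs))).continuousAt.continuousWithinAt)
      (fun s hs => (hg' s (hT.trans (le_of_lt (by rwa [interior_Ici] at hs)))).hasDerivWithinAt) ?_
    intro s hs
    rw [interior_Ici] at hs
    have hq := hstretch s (le_of_lt hs) (curl V (Y s))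
    have h1 : κ * f s ≤ 2 * (‖curl V (Y s)‖ ^ 2 - ⟪fderiv ℝ V (Y s) (curl V (Y s)), curl V (Y s)⟫) := by
      simp only [hf, hκ]
      nlinarith [hq, sq_nonneg ‖curl V (Y s)‖]
    exact mul_nonneg (Real.exp_pos _).le (by linarith)
  -- vorticity bound on the trajectory (continuity of `curl V` on the confining ball)
  obtain ⟨M, hM⟩ := (isCompact_closedBall (0 : EuclideanSpace ℝ (Fin 3)) B).exists_bound_of_continuousOn
    (differentiable_curl_of_contDiff hV).continuous.continuousOn
  have hMt : ∀ t, 0 ≤ t → ‖curl V (Y t)‖ ≤ M := fun t ht => hM _ (mem_closedBall_zero_iff.2 (hB t ht))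
  -- `f T ≤ e^{-κ (t - T)} M²` for all `t ≥ T`
  have hfT : ∀ t, T ≤ t → f T ≤ Real.exp (-κ * (t - T)) * M ^ 2 := by
    intro t ht
    have h1 : g T ≤ g t := hgmono (mem_Ici.2 le_rfl) (mem_Ici.2 ht) ht
    simp only [hg] at h1
    have hft : f t ≤ M ^ 2 := by
      simp only [hf]
      exact pow_le_pow_left₀ (norm_nonneg _) (hMt t (hT.trans ht)) 2
    have h2 : Real.exp (-κ * t) * f t ≤ Real.exp (-κ * t) * M ^ 2 := mul_le_mul_of_nonneg_left hft (Real.exp_pos _).le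
    have h3 : Real.exp (-κ * T) * f T ≤ Real.exp (-κ * t) * M ^ 2 := h1.trans h2
    have h4 : Real.exp (-κ * (t - T)) * M ^ 2 = Real.exp (-κ * t) * M ^ 2 / Real.exp (-κ * T) := by
      rw [show -κ * (t - T) = -κ * t - -κ * T by ring, Real.exp_sub]
      ring
    rw [h4, le_div_iff₀ (Real.exp_pos _)]
    linarith
  -- let `t → ∞`
  have hlim : Tendsto (fun t => Real.exp (-κ * (t - T)) * M ^ 2) atTop (𝓝 0) := by
    have h1 : Tendsto (fun t : ℝ => -κ * (t - T)) atTop atBot := by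
      have : Tendsto (fun t : ℝ => t - T) atTop atTop := tendsto_atTop_add_const_right _ _ tendsto_id
      exact this.const_mul_atTop_of_neg (by linarith)
    have h2 := Real.tendsto_exp_atBot.comp h1
    simpa using h2.mul_const (M ^ 2)
  have hfT0 : f T ≤ 0 :=
    le_of_tendsto_of_tendsto tendsto_const_nhds hlim ((eventually_ge_atTop T).mono fun t ht => hfT t ht)
  have hΩT : curl V (Y T) = 0 := by
    have : f T = 0 := le_antisymm hfT0 (by positivity)
    simpa [hf] using this
  exact curl_comp_eq_zero_of_curl_comp_eq_zero_of_Ici_spiral hS hV hP hdiv heq hY hB hT hΩT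

end Summit.NavierStokesRegularity.NavierStokesRegularity.Theorems.PowerGaugeEulerLiouville.Spiral

end
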